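import Literature.Analysis.FluidPDE.ClassicalOpenStripEnergy
import Mathlib.Algebra.QuadraticDiscriminant

/-!
# Stub `stub_residualTransfer` of line `lojasiewicz-lamb-floor-ladder` (crux stmt-AnomalousDissipation-13038)

The `g = 1` rung of the graded transfer of the line, for the crux
`TaylorCertificates.SteadyStatesLoudBounded`: **Lamb rigidity with a residual cap implies a floor on the
dissipation of steady states.**  Let `f : T³ → ℝ³` be smooth and suppose `RigidAt f E c δ₀`: for every smooth
divergence-free mean-zero `u` with `∫|u|² ≤ E` and every bound `R ∈ [0, δ₀]` of the Euler residual functional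
`w ↦ ∫⟪(u·∇)u − f, w⟫` in the dual norm over smooth divergence-free mean-zero tests
(`|∫⟪(u·∇)u − f, w⟫| ≤ R‖∇w‖₂` with `‖∇w‖₂ = √(Torus.gradNormSq w)`), one has `c ≤ R‖∇u‖₂`.  Then every
smooth divergence-free mean-zero steady state `u` of `NS_ν(f)` (`∫⟪νΔu − (u·∇)u + f, w⟫ = 0` for all such
`w`) with `∫|u|² ≤ E` satisfies `min c (δ₀²/ν) ≤ ν‖∇u‖₂²`.

Proof.  At a steady state the residual functional is `w ↦ ν∫⟪Δu, w⟫ = −ν∑ᵢ∫⟪∂ᵢu, ∂ᵢw⟫` (Green's first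
identity on `T³`, `Torus.integral_inner_laplacian_eq_neg_sum`), so by the Cauchy–Schwarz inequality in
`L²(T³; ℝ^{3×3})` (`abs_sum_integral_inner_partialDeriv_le`, obtained from the non-negativity of the
quadratic `t ↦ ∫∑ᵢ‖t∂ᵢu + ∂ᵢw‖²` and `discrim_le_zero`) the number `R := ν√(gradNormSq u) ≥ 0` is an
admissible residual bound.  If `R ≤ δ₀`, rigidity gives `c ≤ R√(gradNormSq u) = ν·gradNormSq u`; otherwise
`ν·gradNormSq u = R²/ν > δ₀²/ν`.  Uses `0 < ν` and `0 < δ₀`; no sign condition on `c` or `E`.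
-/

-- `Summit.<Summit>.<Problem>` is the tree's mandated summit-side namespace (CONVENTIONS §2); single-conjunct summit, duplicate deliberate.
set_option linter.dupNamespace false

noncomputable section

namespace Summit.AnomalousDissipation.AnomalousDissipation.Theorems.SteadyStatesLoudBounded.ResidualTransfer

open MeasureTheory Filter Topology UnitAddTorus
open scoped InnerProductSpace ENNReal
open Literature.Analysis.FunctionSpaces Literature.Analysis.FluidPDE

variable {d : Type*} [Fintype d] [DecidableEq d]

/-! ## §1 Cauchy–Schwarz for the Frobenius pairing of gradients -/

omit [DecidableEq d] in
/-- Pointwise expansion `∑ᵢ ‖t aᵢ + bᵢ‖² = t² ∑ᵢ‖aᵢ‖² + 2t ∑ᵢ⟪aᵢ, bᵢ⟫ + ∑ᵢ‖bᵢ‖²` in a real inner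
product space. [folklore] -/
theorem sum_norm_smul_add_sq {G : Type*} [NormedAddCommGroup G] [InnerProductSpace ℝ G]
    (a b : d → G) (t : ℝ) :
    ∑ i, ‖t • a i + b i‖ ^ 2 =
      t * t * (∑ i, ‖a i‖ ^ 2) + 2 * t * (∑ i, ⟪a i, b i⟫_ℝ) + ∑ i, ‖b i‖ ^ 2 := by
  rw [Finset.mul_sum, Finset.mul_sum, ← Finset.sum_add_distrib, ← Finset.sum_add_distrib]
  refine Finset.sum_congr rfl fun i _ => ?_
  rw [norm_add_sq_real, norm_smul, real_inner_smul_left, mul_pow, Real.norm_eq_abs, sq_abs]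
  ring

/-- **Cauchy–Schwarz for the gradient pairing**: for smooth `u, w : T^d → ℝ^d`,
`|∑ᵢ ∫⟪∂ᵢu, ∂ᵢw⟫| ≤ ‖∇u‖₂ ‖∇w‖₂` with `‖∇v‖₂ = √(Torus.gradNormSq v)` (the quadratic
`t ↦ ∫∑ᵢ‖t∂ᵢu + ∂ᵢw‖² = t²‖∇u‖₂² + 2t∑ᵢ∫⟪∂ᵢu, ∂ᵢw⟫ + ‖∇w‖₂²` is non-negative, hence has non-positive
discriminant). [folklore] -/
theorem abs_sum_integral_inner_partialDeriv_le {u w : UnitAddTorus d → EuclideanSpace ℝ d}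
    (hu : Torus.IsSmooth u) (hw : Torus.IsSmooth w) :
    |∑ i, ∫ x, ⟪Torus.partialDeriv i u x, Torus.partialDeriv i w x⟫_ℝ| ≤
      Real.sqrt (Torus.gradNormSq u) * Real.sqrt (Torus.gradNormSq w) := by
  set S := ∑ i, ∫ x, ⟪Torus.partialDeriv i u x, Torus.partialDeriv i w x⟫_ℝ with hS
  -- integrability of the three pointwise sums
  have iA : Integrable (fun x => ∑ i, ‖Torus.partialDeriv i u x‖ ^ 2) volume :=
    integrable_finsetSum _ fun i _ => (hu.partialDeriv i).norm_sq.integrable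
  have iB : Integrable (fun x => ∑ i, ‖Torus.partialDeriv i w x‖ ^ 2) volume :=
    integrable_finsetSum _ fun i _ => (hw.partialDeriv i).norm_sq.integrable
  have iH : Integrable (fun x => ∑ i, ⟪Torus.partialDeriv i u x, Torus.partialDeriv i w x⟫_ℝ) volume :=
    integrable_finsetSum _ fun i _ => ((hu.partialDeriv i).inner (hw.partialDeriv i)).integrable
  have hH : ∫ x, ∑ i, ⟪Torus.partialDeriv i u x, Torus.partialDeriv i w x⟫_ℝ = S :=
    integral_finsetSum _ fun i _ => ((hu.partialDeriv i).inner (hw.partialDeriv i)).integrable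
  -- the non-negative quadratic
  have hquad : ∀ t : ℝ, 0 ≤ Torus.gradNormSq u * (t * t) + 2 * S * t + Torus.gradNormSq w := by
    intro t
    have h0 : 0 ≤ ∫ x, ∑ i, ‖t • Torus.partialDeriv i u x + Torus.partialDeriv i w x‖ ^ 2 :=
      integral_nonneg fun x => Finset.sum_nonneg fun i _ => sq_nonneg _
    have hexp : ∫ x, ∑ i, ‖t • Torus.partialDeriv i u x + Torus.partialDeriv i w x‖ ^ 2 =
        t * t * Torus.gradNormSq u + 2 * t * S + Torus.gradNormSq w := by
      have iAH : Integrable (fun x => t * t * ∑ i, ‖Torus.partialDeriv i u x‖ ^ 2 +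
          2 * t * ∑ i, ⟪Torus.partialDeriv i u x, Torus.partialDeriv i w x⟫_ℝ) volume :=
        (iA.const_mul _).add (iH.const_mul _)
      simp_rw [sum_norm_smul_add_sq]
      rw [integral_add iAH iB, integral_add (iA.const_mul _) (iH.const_mul _), integral_const_mul,
        integral_const_mul, hH]
      rfl
    rw [hexp] at h0
    nlinarith [h0]
  have hdisc := discrim_le_zero hquad
  rw [discrim] at hdisc
  have hsq : S ^ 2 ≤ Torus.gradNormSq u * Torus.gradNormSq w := by nlinarith [hdisc]
  rw [← Real.sqrt_mul (Torus.gradNormSq_nonneg u)]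
  exact Real.abs_le_sqrt hsq

/-! ## §2 The residual functional of a steady state -/

/-- At a smooth steady state of `NS_ν(f)` tested against a smooth `w`, the Euler residual pairing is the
viscous pairing: `∫⟪νΔu − (u·∇)u + f, w⟫ = 0 ⟹ ∫⟪(u·∇)u − f, w⟫ = −ν ∑ᵢ ∫⟪∂ᵢu, ∂ᵢw⟫` (linearity of the
Bochner integral on the integrable summands and Green's first identity
`Torus.integral_inner_laplacian_eq_neg_sum`). [folklore] -/
theorem integral_inner_convect_sub_eq {ν : ℝ} {f u w : UnitAddTorus d → EuclideanSpace ℝ d}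
    (hf : Torus.IsSmooth f) (hu : Torus.IsSmooth u) (hw : Torus.IsSmooth w)
    (hst : ∫ x, ⟪ν • Torus.laplacian u x - Torus.convect u u x + f x, w x⟫_ℝ = 0) :
    ∫ x, ⟪Torus.convect u u x - f x, w x⟫_ℝ =
      -(ν * ∑ i, ∫ x, ⟪Torus.partialDeriv i u x, Torus.partialDeriv i w x⟫_ℝ) := by
  -- adapted from Cruxes/SteadyStatesLoudBounded/Disproof.lean §1 (`residual_pairing_eq`)
  have iL : Integrable (fun x => ⟪ν • Torus.laplacian u x, w x⟫_ℝ) volume :=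
    ((hu.laplacian.smul ν).inner hw).integrable
  have iC : Integrable (fun x => ⟪Torus.convect u u x, w x⟫_ℝ) volume :=
    ((hu.convect hu).inner hw).integrable
  have iF : Integrable (fun x => ⟪f x, w x⟫_ℝ) volume := (hf.inner hw).integrable
  have iLC : Integrable (fun x => ⟪ν • Torus.laplacian u x, w x⟫_ℝ - ⟪Torus.convect u u x, w x⟫_ℝ) volume :=
    iL.sub iC
  simp_rw [inner_add_left, inner_sub_left] at hst
  rw [integral_add iLC iF, integral_sub iL iC] at hst
  have hlap : ∫ x, ⟪ν • Torus.laplacian u x, w x⟫_ℝ =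
      -(ν * ∑ i, ∫ x, ⟪Torus.partialDeriv i u x, Torus.partialDeriv i w x⟫_ℝ) := by
    simp_rw [real_inner_smul_left]
    rw [integral_const_mul, Torus.integral_inner_laplacian_eq_neg_sum hu hw, mul_neg]
  simp_rw [inner_sub_left]
  rw [integral_sub iC iF]
  linarith

/-- **The residual bound of a steady state**: at a smooth steady state `u` of `NS_ν(f)`, `ν ≥ 0`, the Euler
residual functional is bounded in the dual enstrophy norm by `R = ν‖∇u‖₂`:
`|∫⟪(u·∇)u − f, w⟫| ≤ ν √(gradNormSq u) √(gradNormSq w)` for every smooth test `w` against which the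
steady identity holds. [folklore] -/
theorem abs_integral_inner_convect_sub_le {ν : ℝ} {f u w : UnitAddTorus d → EuclideanSpace ℝ d}
    (hν : 0 ≤ ν) (hf : Torus.IsSmooth f) (hu : Torus.IsSmooth u) (hw : Torus.IsSmooth w)
    (hst : ∫ x, ⟪ν • Torus.laplacian u x - Torus.convect u u x + f x, w x⟫_ℝ = 0) :
    |∫ x, ⟪Torus.convect u u x - f x, w x⟫_ℝ| ≤
      ν * Real.sqrt (Torus.gradNormSq u) * Real.sqrt (Torus.gradNormSq w) := by
  rw [integral_inner_convect_sub_eq hf hu hw hst, abs_neg, abs_mul, abs_of_nonneg hν, mul_assoc]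
  exact mul_le_mul_of_nonneg_left (abs_sum_integral_inner_partialDeriv_le hu hw) hν

/-! ## §3 The stub -/

/-- **S2 `stub_residualTransfer`** — the `g = 1` rung of the graded transfer with the residual cap:
`RigidAt f E c δ₀ ⟹ min c (δ₀²/ν) ≤ ν·gradNormSq u` for every smooth divergence-free mean-zero steady
state `u` of `NS_ν(f)` with `∫|u|² ≤ E` (`0 < ν`, `0 < δ₀`).  With `R := ν√(gradNormSq u)`, an admissible
residual bound by `abs_integral_inner_convect_sub_le`: if `R ≤ δ₀` rigidity gives
`c ≤ R√(gradNormSq u) = ν·gradNormSq u`, else `δ₀²/ν < R²/ν = ν·gradNormSq u`. [folklore] -/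
theorem stub_residualTransfer :
    ∀ (ν E c δ₀ : ℝ) (f : UnitAddTorus (Fin 3) → EuclideanSpace ℝ (Fin 3)),
      0 < ν → 0 < δ₀ → Torus.IsSmooth f →
      (∀ u : UnitAddTorus (Fin 3) → EuclideanSpace ℝ (Fin 3),
        Torus.IsSmooth u → Torus.IsDivFree u → Torus.HasZeroMean u → ∫ x, ‖u x‖ ^ 2 ≤ E →
        ∀ R : ℝ, 0 ≤ R →
          (∀ w : UnitAddTorus (Fin 3) → EuclideanSpace ℝ (Fin 3),
            Torus.IsSmooth w → Torus.IsDivFree w → Torus.HasZeroMean w →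
            |∫ x, inner ℝ (Torus.convect u u x - f x) (w x)| ≤ R * Real.sqrt (Torus.gradNormSq w)) →
          R ≤ δ₀ → c ≤ R * Real.sqrt (Torus.gradNormSq u)) →
      ∀ u : UnitAddTorus (Fin 3) → EuclideanSpace ℝ (Fin 3),
        Torus.IsSmooth u → Torus.IsDivFree u → Torus.HasZeroMean u →
        (∀ w : UnitAddTorus (Fin 3) → EuclideanSpace ℝ (Fin 3),
          Torus.IsSmooth w → Torus.IsDivFree w → Torus.HasZeroMean w →
          ∫ x, inner ℝ (ν • Torus.laplacian u x - Torus.convect u u x + f x) (w x) = 0) →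
        ∫ x, ‖u x‖ ^ 2 ≤ E →
        min c (δ₀ ^ 2 / ν) ≤ ν * Torus.gradNormSq u := by
  intro ν E c δ₀ f hν hδ₀ hf hrig u hu hud huz hst hE
  have hG : 0 ≤ Torus.gradNormSq u := Torus.gradNormSq_nonneg u
  set R := ν * Real.sqrt (Torus.gradNormSq u) with hR
  have hR0 : 0 ≤ R := mul_nonneg hν.le (Real.sqrt_nonneg _)
  have hRG : R * Real.sqrt (Torus.gradNormSq u) = ν * Torus.gradNormSq u := by
    rw [hR, mul_assoc, Real.mul_self_sqrt hG]
  have hbound : ∀ w : UnitAddTorus (Fin 3) → EuclideanSpace ℝ (Fin 3),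
      Torus.IsSmooth w → Torus.IsDivFree w → Torus.HasZeroMean w →
      |∫ x, inner ℝ (Torus.convect u u x - f x) (w x)| ≤ R * Real.sqrt (Torus.gradNormSq w) :=
    fun w hw hwd hwz => abs_integral_inner_convect_sub_le hν.le hf hu hw (hst w hw hwd hwz)
  rcases le_or_gt R δ₀ with hle | hlt
  · have h := hrig u hu hud huz hE R hR0 hbound hle
    rw [hRG] at h
    exact (min_le_left _ _).trans h
  · have hR2 : R ^ 2 = ν * (ν * Torus.gradNormSq u) := by
      rw [hR, mul_pow, Real.sq_sqrt hG]
      ring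
    have hδR : δ₀ ^ 2 < R ^ 2 := by nlinarith [hlt, hδ₀]
    have h : δ₀ ^ 2 / ν ≤ ν * Torus.gradNormSq u := by
      rw [div_le_iff₀ hν]
      nlinarith [hδR, hR2]
    exact (min_le_right _ _).trans h

end Summit.AnomalousDissipation.AnomalousDissipation.Theorems.SteadyStatesLoudBounded.ResidualTransfer

end
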